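import Summits.CriticalPhenomena.PercolationContinuityZ3.Theorems.Transplant.TwoAxisExitFrameSides
import Summits.CriticalPhenomena.PercolationContinuityZ3.Theorems.Transplant.SkelPhiAffinePlacement
import HarnessLib

/-!
# N1 ({±1} node), kit adapter (hp-8 g33 for p1-g11's `kitClauseA'`, N-K5b/N-K6c): the AFFINE side forms of an exit frame — level sides as in
# `TwoAxisExitFrameSides` (slope `U`, climbing coefficient `|coef (inward axis)|`), raw sides `U`-SCALED (form `±U·e_b`, slope `U`, climbing
# coefficient `U`) so that ONE kit offset `A` serves all four sides (p1-g11 16:01Z: with unscaled raw sides the raw kit column would be `~U` rows);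
# `sideFormsU_exitFrame` + `sideFormsU_exitFrame_isAffine` (p1's `SideForm.IsAffine U C`), and the face-frame instances `FinePrm.sideFormsU_frame`
# + `FinePrm.sideFormsU_frame_isAffine` (U = D, C = c_I·|A|·|lvGen I b| on level sides, = D on raw sides; `n := ⌈D/3⌉ ≤ C`, `U ≤ 3n` by `hU3`)

builds on p205010 (kernel theorem, internal audit signed; external expert review pending) — nothing in this file uses p205010; planar arithmetic only.
Lane `prim-bschramm`, seat `prim-hp-8` (gen 33); helper file (`--supports stmt-CriticalPhenomena-4575 --as helper`).
* §1 `sideFormRawLoU` / `sideFormRawHiU` (thresholds `U·(Lo (oth I) + m + φt_b)` / `U·(m − Hi (oth I) − φt_b)`), **`sideFormsU_exitFrame`**, the affine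
  certificates `sideFormLvLo_isAffine`, `sideFormLvHi_isAffine`, `sideFormRawLoU_isAffine`, `sideFormRawHiU_isAffine`, **`sideFormsU_exitFrame_isAffine`**
  (`C i σ := if i = I then sg·coef cα cβ a else U`; needs `|cα| + |cβ| ≤ U`);
* §2 **`FinePrm.sideFormsU_frame`**, `FinePrm.climC` (the climbing coefficients), **`FinePrm.sideFormsU_frame_isAffine`**.
[cite: KozmaNitzan2024, §4 Lemma 10, p. 21 ("Q ⊆ S")] [cite: MartineauTassion2017, §4.3]
-/

noncomputable section

open scoped Classical

namespace Summit.CriticalPhenomena.PercolationContinuityZ3.Theorems.Transplant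

namespace Skelφ

open Literature.Probability.LatticeModels
open Literature.Probability.Percolation.KozmaNitzan.Cells (oth oth_ne eq_oth_of_ne oth_oth)

variable {V : Type} {φ : V → Site 2}

/-! ## §1 `U`-scaled raw sides; the affine certificates -/

section Sides

variable (φ) (t : V) (I b : Fin 2) (cα cβ U s : ℤ) (hU : 0 < U) (a : Fin 2) (sg : ℤˣ) (hclim : 0 < (sg : ℤ) * coef cα cβ a) (Lo Hi : Site 2)

include hU in
/-- **The lower raw side, `U`-scaled** `(oth I, −1)`: form `U·e_b`, depth `≥ m` iff `U·φ_b(v) ≥ U·(Lo (oth I) + m + φ_b(t))`. [this work] -/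
def sideFormRawLoU : SideForm (exitFrame φ t I b cα cβ U s) φ Lo Hi (oth I) (-1) where
  cα := U * (if b = 0 then 1 else 0)
  cβ := U * (if b = 0 then 0 else 1)
  θ := fun m => U * (Lo (oth I) + m + φ t b)
  a := b
  s := 1
  clim := by
    obtain rfl | rfl : b = 0 ∨ b = 1 := by fin_cases b <;> simp
    · simp [coef]; exact hU
    · simp [coef]; exact hU
  depth_iff := fun v m => by
    have hne : ((-1 : ℤˣ) : ℤ) ≠ 1 := by decide
    simp only [sdepth, if_neg hne]
    rw [exitFrame_raw_eq]
    have hlin : linForm (U * (if b = 0 then 1 else 0)) (U * (if b = 0 then 0 else 1)) (φ v) = U * φ v b := by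
      obtain rfl | rfl : b = 0 ∨ b = 1 := by fin_cases b <;> simp
      · simp [linForm]
      · simp [linForm]
    rw [hlin]
    constructor
    · intro h; nlinarith
    · intro h
      by_contra h'
      push Not at h'
      have : U * φ v b < U * (Lo (oth I) + m + φ t b) := by nlinarith
      linarith

include hU in
/-- **The upper raw side, `U`-scaled** `(oth I, 1)`: form `−U·e_b`, depth `≥ m` iff `−U·φ_b(v) ≥ U·(m − Hi (oth I) − φ_b(t))`. [this work] -/
def sideFormRawHiU : SideForm (exitFrame φ t I b cα cβ U s) φ Lo Hi (oth I) 1 where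
  cα := -(U * (if b = 0 then 1 else 0))
  cβ := -(U * (if b = 0 then 0 else 1))
  θ := fun m => U * (m - Hi (oth I) - φ t b)
  a := b
  s := -1
  clim := by
    rw [coef_neg, Units.val_neg, Units.val_one]
    obtain rfl | rfl : b = 0 ∨ b = 1 := by fin_cases b <;> simp
    · simp [coef]; exact hU
    · simp [coef]; exact hU
  depth_iff := fun v m => by
    simp only [sdepth, Units.val_one, if_true]
    rw [exitFrame_raw_eq, linForm_neg_coef]
    have hlin : linForm (U * (if b = 0 then 1 else 0)) (U * (if b = 0 then 0 else 1)) (φ v) = U * φ v b := by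
      obtain rfl | rfl : b = 0 ∨ b = 1 := by fin_cases b <;> simp
      · simp [linForm]
      · simp [linForm]
    rw [hlin]
    constructor
    · intro h; nlinarith
    · intro h
      by_contra h'
      push Not at h'
      have : U * (Hi (oth I) - m) < U * (φ v b - φ t b) := by nlinarith
      linarith

include hU in
/-- **ALL FOUR SIDES, raw sides `U`-scaled** — the `SF` argument of p1-g11's `kitClauseA'` for a box of an exit frame. [this work] -/
def sideFormsU_exitFrame : ∀ (i : Fin 2) (σ : ℤˣ), SideForm (exitFrame φ t I b cα cβ U s) φ Lo Hi i σ := fun i σ => by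
  by_cases hi : i = I
  · subst hi
    by_cases hσ : σ = 1
    · subst hσ; exact sideFormLvHi φ t i b cα cβ U s hU a sg hclim Lo Hi
    · have hσ' : σ = -1 := (Int.units_eq_one_or σ).resolve_left hσ
      subst hσ'; exact sideFormLvLo φ t i b cα cβ U s hU a sg hclim Lo Hi
  · have hi' : i = oth I := eq_oth_of_ne hi
    subst hi'
    by_cases hσ : σ = 1
    · subst hσ; exact sideFormRawHiU φ t I b cα cβ U s hU Lo Hi
    · have hσ' : σ = -1 := (Int.units_eq_one_or σ).resolve_left hσ
      subst hσ'; exact sideFormRawLoU φ t I b cα cβ U s hU Lo Hi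

/-- `|coef (oth a)| ≤ |cα| + |cβ|`. [folklore] -/
theorem abs_coef_oth_le : |coef cα cβ (oth a)| ≤ |cα| + |cβ| := by
  obtain rfl | rfl : a = 0 ∨ a = 1 := by fin_cases a <;> simp
  · rw [show oth (0 : Fin 2) = 1 from rfl]; simp [coef]
  · rw [show oth (1 : Fin 2) = 0 from rfl]; simp [coef]

include hU in
/-- The lower level side is affine of slope `U`, climbing coefficient `sg·coef a` (`|cα| + |cβ| ≤ U`). [folklore] -/
theorem sideFormLvLo_isAffine (hUL : |cα| + |cβ| ≤ U) :
    (sideFormLvLo φ t I b cα cβ U s hU a sg hclim Lo Hi).IsAffine U ((sg : ℤ) * coef cα cβ a) := by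
  refine ⟨fun m m' => by simp only [sideFormLvLo]; ring, rfl, ?_, ?_⟩
  · exact (abs_coef_oth_le cα cβ a).trans hUL
  · rw [SideForm.UL_eq]; exact hUL

include hU in
/-- The upper level side is affine of slope `U`, climbing coefficient `sg·coef a`. [folklore] -/
theorem sideFormLvHi_isAffine (hUL : |cα| + |cβ| ≤ U) :
    (sideFormLvHi φ t I b cα cβ U s hU a sg hclim Lo Hi).IsAffine U ((sg : ℤ) * coef cα cβ a) := by
  refine ⟨fun m m' => by simp only [sideFormLvHi]; ring, ?_, ?_, ?_⟩
  · show (((-sg : ℤˣ)) : ℤ) * coef (-cα) (-cβ) a = (sg : ℤ) * coef cα cβ a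
    rw [coef_neg, Units.val_neg]; ring
  · show |coef (-cα) (-cβ) (oth a)| ≤ U
    rw [coef_neg, abs_neg]; exact (abs_coef_oth_le cα cβ a).trans hUL
  · rw [SideForm.UL_eq]; show |(-cα)| + |(-cβ)| ≤ U; rw [abs_neg, abs_neg]; exact hUL

include hU in
/-- The `U`-scaled lower raw side is affine of slope `U`, climbing coefficient `U`. [folklore] -/
theorem sideFormRawLoU_isAffine : (sideFormRawLoU φ t I b cα cβ U s hU Lo Hi).IsAffine U U := by
  refine ⟨fun m m' => by simp only [sideFormRawLoU]; ring, ?_, ?_, ?_⟩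
  · show ((1 : ℤˣ) : ℤ) * coef (U * (if b = 0 then 1 else 0)) (U * (if b = 0 then 0 else 1)) b = U
    obtain rfl | rfl : b = 0 ∨ b = 1 := by fin_cases b <;> simp
    · simp [coef]
    · simp [coef]
  · show |coef (U * (if b = 0 then 1 else 0)) (U * (if b = 0 then 0 else 1)) (oth b)| ≤ U
    obtain rfl | rfl : b = 0 ∨ b = 1 := by fin_cases b <;> simp
    · rw [show oth (0 : Fin 2) = 1 from rfl]; simp [coef]; exact hU.le
    · rw [show oth (1 : Fin 2) = 0 from rfl]; simp [coef]; exact hU.le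
  · rw [SideForm.UL_eq]
    show |U * (if b = 0 then (1 : ℤ) else 0)| + |U * (if b = 0 then (0 : ℤ) else 1)| ≤ U
    obtain rfl | rfl : b = 0 ∨ b = 1 := by fin_cases b <;> simp
    · simp [abs_of_pos hU]
    · simp [abs_of_pos hU]

include hU in
/-- The `U`-scaled upper raw side is affine of slope `U`, climbing coefficient `U`. [folklore] -/
theorem sideFormRawHiU_isAffine : (sideFormRawHiU φ t I b cα cβ U s hU Lo Hi).IsAffine U U := by
  refine ⟨fun m m' => by simp only [sideFormRawHiU]; ring, ?_, ?_, ?_⟩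
  · show (((-1 : ℤˣ)) : ℤ) * coef (-(U * (if b = 0 then 1 else 0))) (-(U * (if b = 0 then 0 else 1))) b = U
    rw [coef_neg]
    obtain rfl | rfl : b = 0 ∨ b = 1 := by fin_cases b <;> simp
    · simp [coef]
    · simp [coef]
  · show |coef (-(U * (if b = 0 then 1 else 0))) (-(U * (if b = 0 then 0 else 1))) (oth b)| ≤ U
    rw [coef_neg, abs_neg]
    obtain rfl | rfl : b = 0 ∨ b = 1 := by fin_cases b <;> simp
    · rw [show oth (0 : Fin 2) = 1 from rfl]; simp [coef]; exact hU.le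
    · rw [show oth (1 : Fin 2) = 0 from rfl]; simp [coef]; exact hU.le
  · rw [SideForm.UL_eq]
    show |-(U * (if b = 0 then (1 : ℤ) else 0))| + |-(U * (if b = 0 then (0 : ℤ) else 1))| ≤ U
    rw [abs_neg, abs_neg]
    obtain rfl | rfl : b = 0 ∨ b = 1 := by fin_cases b <;> simp
    · simp [abs_of_pos hU]
    · simp [abs_of_pos hU]

include hU in
/-- **The four side forms of an exit-frame box are affine of slope `U`** with climbing coefficients `sg·coef a` (level sides) / `U` (raw sides), as soon as
`|cα| + |cβ| ≤ U` (the frame's Lipschitz condition). [this work] -/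
theorem sideFormsU_exitFrame_isAffine (hUL : |cα| + |cβ| ≤ U) (i : Fin 2) (σ : ℤˣ) :
    (sideFormsU_exitFrame φ t I b cα cβ U s hU a sg hclim Lo Hi i σ).IsAffine U (if i = I then (sg : ℤ) * coef cα cβ a else U) := by
  by_cases hi : i = I
  · subst hi
    rw [if_pos rfl]
    rcases Int.units_eq_one_or σ with hσ | hσ <;> subst hσ
    · simp only [sideFormsU_exitFrame, dif_pos]
      exact sideFormLvHi_isAffine φ t i b cα cβ U s hU a sg hclim Lo Hi hUL
    · have hne : (-1 : ℤˣ) ≠ 1 := by decide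
      simp only [sideFormsU_exitFrame, dif_pos, dif_neg hne]
      exact sideFormLvLo_isAffine φ t i b cα cβ U s hU a sg hclim Lo Hi hUL
  · rw [if_neg hi]
    have hi' : i = oth I := eq_oth_of_ne hi
    subst hi'
    rcases Int.units_eq_one_or σ with hσ | hσ <;> subst hσ
    · simp only [sideFormsU_exitFrame, dif_neg hi, dif_pos]
      exact sideFormRawHiU_isAffine φ t I b cα cβ U s hU Lo Hi
    · have hne : (-1 : ℤˣ) ≠ 1 := by decide
      simp only [sideFormsU_exitFrame, dif_neg hi, dif_neg hne]
      exact sideFormRawLoU_isAffine φ t I b cα cβ U s hU Lo Hi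

end Sides

/-! ## §2 The affine side forms of the (F) face frame -/

namespace FinePrm

variable (pr : FinePrm) (φ) (t : V) (I b : Fin 2)

/-- **The side forms of the face frame with `D`-scaled raw sides**, for every box `Icc Lo Hi` (`0 < c_I`, `A ≠ 0`, `lvGen I b ≠ 0`, `0 < D`);
by cases on the axis `I` (the frame IS the corresponding exit frame definitionally). [this work] -/
def sideFormsU_frame : (I b : Fin 2) → (hc : 0 < pr.cOf I) → (hA : pr.A ≠ 0) → (hnz : pr.lvGen I b ≠ 0) → (hD : 0 < pr.D) → (Lo Hi : Site 2) →
    ∀ (i : Fin 2) (σ : ℤˣ), SideForm (pr.frame φ t I b) φ Lo Hi i σ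
  | ⟨0, _⟩, b, hc, hA, hnz, hD, Lo, Hi => fun i σ =>
      sideFormsU_exitFrame φ t 0 b (pr.c₀ * pr.A * pr.vβ) (-(pr.c₀ * pr.A * pr.vα)) pr.D (pr.D / 2) hD (oth b)
        (Classical.choose (pr.exists_clim 0 b hc hA hnz)) ((Classical.choose_spec (pr.exists_clim 0 b hc hA hnz)).1 rfl) Lo Hi i σ
  | ⟨1, _⟩, b, hc, hA, hnz, hD, Lo, Hi => fun i σ =>
      sideFormsU_exitFrame φ t 1 b (-(pr.c₁ * pr.A * pr.h)) (pr.c₁ * pr.A * pr.n) pr.D (pr.D / 2) hD (oth b)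
        (Classical.choose (pr.exists_clim 1 b hc hA hnz)) ((Classical.choose_spec (pr.exists_clim 1 b hc hA hnz)).2 rfl) Lo Hi i σ

/-- **The climbing coefficients of the face frame's sides**: `c_I·|A|·|lvGen I b|` on the level sides, `D` on the raw sides. [this work] -/
def climC (i : Fin 2) : ℤ := if i = I then pr.cOf I * |pr.A| * |pr.lvGen I b| else pr.D

/-- The inward level coefficient of the face frame in absolute value: `|coef (oth b)| = c_I·|A|·|lvGen I b|` for both frames. [folklore] -/
theorem abs_coef_inward (hc : 0 ≤ pr.cOf I) :
    (I = 0 → |coef (pr.c₀ * pr.A * pr.vβ) (-(pr.c₀ * pr.A * pr.vα)) (oth b)| = pr.cOf I * |pr.A| * |pr.lvGen I b|) ∧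
      (I = 1 → |coef (-(pr.c₁ * pr.A * pr.h)) (pr.c₁ * pr.A * pr.n) (oth b)| = pr.cOf I * |pr.A| * |pr.lvGen I b|) := by
  constructor
  · intro hI; subst hI
    rw [cOf_zero] at hc ⊢
    have hcf := abs_coef_v pr.c₀ pr.A pr.vα pr.vβ hc
    obtain rfl | rfl : b = 0 ∨ b = 1 := by fin_cases b <;> simp
    · rw [show oth (0 : Fin 2) = 1 from rfl, hcf.2, lvGen_zero_zero]
    · rw [show oth (1 : Fin 2) = 0 from rfl, hcf.1, lvGen_zero_one]
  · intro hI; subst hI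
    rw [cOf_one] at hc ⊢
    have hcf := abs_coef_u pr.c₁ pr.A pr.n pr.h hc
    obtain rfl | rfl : b = 0 ∨ b = 1 := by fin_cases b <;> simp
    · rw [show oth (0 : Fin 2) = 1 from rfl, hcf.2, lvGen_one_zero]
    · rw [show oth (1 : Fin 2) = 0 from rfl, hcf.1, lvGen_one_one]

/-- A positive multiple `sg·κ > 0` with `sg = ±1` is `|κ|`. [folklore] -/
theorem units_mul_eq_abs {sg : ℤˣ} {κ : ℤ} (h : 0 < (sg : ℤ) * κ) : (sg : ℤ) * κ = |κ| := by
  rcases Int.units_eq_one_or sg with rfl | rfl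
  · rw [Units.val_one, one_mul] at h ⊢; exact (abs_of_pos h).symm
  · rw [Units.val_neg, Units.val_one, neg_mul, one_mul] at h ⊢; rw [abs_of_neg (by linarith)]

/-- **The face frame's side forms are affine of slope `D`** with climbing coefficients `climC` (`c_I·L_I ≤ D`). [this work] -/
theorem sideFormsU_frame_isAffine (I b : Fin 2) (hc : 0 < pr.cOf I) (hA : pr.A ≠ 0) (hnz : pr.lvGen I b ≠ 0) (hD : 0 < pr.D)
    (hL : pr.cOf I * pr.L I ≤ pr.D) (Lo Hi : Site 2) (i : Fin 2) (σ : ℤˣ) :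
    (pr.sideFormsU_frame φ t I b hc hA hnz hD Lo Hi i σ).IsAffine pr.D (pr.climC I b i) := by
  have hcoef := pr.abs_coef_inward I b hc.le
  unfold climC
  obtain rfl | rfl : I = 0 ∨ I = 1 := by fin_cases I <;> simp
  · set h := pr.exists_clim 0 b hc hA hnz with hh
    rw [cOf_zero] at hL; rw [L_zero] at hL
    have hUL : |pr.c₀ * pr.A * pr.vβ| + |-(pr.c₀ * pr.A * pr.vα)| ≤ pr.D := by
      rw [abs_vcoef pr.c₀ pr.A pr.vα pr.vβ (by rw [cOf_zero] at hc; exact hc.le)]; rwa [add_comm] at hL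
    have key := sideFormsU_exitFrame_isAffine φ t 0 b (pr.c₀ * pr.A * pr.vβ) (-(pr.c₀ * pr.A * pr.vα)) pr.D (pr.D / 2) hD (oth b)
      (Classical.choose h) ((Classical.choose_spec h).1 rfl) Lo Hi hUL i σ
    have hC : (if i = 0 then ((Classical.choose h : ℤˣ) : ℤ) * coef (pr.c₀ * pr.A * pr.vβ) (-(pr.c₀ * pr.A * pr.vα)) (oth b) else pr.D) =
        (if i = 0 then pr.cOf 0 * |pr.A| * |pr.lvGen 0 b| else pr.D) := by
      split_ifs
      · rw [units_mul_eq_abs ((Classical.choose_spec h).1 rfl), hcoef.1 rfl]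
      · rfl
    rw [← hC]
    exact key
  · set h := pr.exists_clim 1 b hc hA hnz with hh
    rw [cOf_one] at hL; rw [L_one] at hL
    have hUL : |-(pr.c₁ * pr.A * pr.h)| + |pr.c₁ * pr.A * pr.n| ≤ pr.D := by
      rw [abs_ucoef pr.c₁ pr.A pr.n pr.h (by rw [cOf_one] at hc; exact hc.le)]; exact hL
    have key := sideFormsU_exitFrame_isAffine φ t 1 b (-(pr.c₁ * pr.A * pr.h)) (pr.c₁ * pr.A * pr.n) pr.D (pr.D / 2) hD (oth b)
      (Classical.choose h) ((Classical.choose_spec h).2 rfl) Lo Hi hUL i σ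
    have hC : (if i = 1 then ((Classical.choose h : ℤˣ) : ℤ) * coef (-(pr.c₁ * pr.A * pr.h)) (pr.c₁ * pr.A * pr.n) (oth b) else pr.D) =
        (if i = 1 then pr.cOf 1 * |pr.A| * |pr.lvGen 1 b| else pr.D) := by
      split_ifs
      · rw [units_mul_eq_abs ((Classical.choose_spec h).2 rfl), hcoef.2 rfl]
      · rfl
    rw [← hC]
    exact key

end FinePrm

end Skelφ

end Summit.CriticalPhenomena.PercolationContinuityZ3.Theorems.Transplant

end
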